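import Summits.AtomisticToContinuum.Crystallization.Theorems.GappedShellCensusCleanLimitsHaveWindowsBoxPinningA

/-!
# Box pinning, part B: polar and tropical parts of an index shell; the interlayer upper bound

Support for the registered stubs `stub_geometricBounds` / `stub_boxPinning` of line `Sketch` of the crux
`GappedShellCensus.CleanLimitsHaveWindows` (stmt-AtomisticToContinuum-15932), continuing part A.

* Regime `a' ≥ 63a/50` (used by the in-plane upper bound, part C): every index of the shell of `(m, 0, 0)` is
  polar (form `0`) or tropical (form `4`), above or below (`bpJ_subset`); aligned layers are vertically
  `≥ a(1 - 1/50)` apart (`bp_gap_aligned`); the polar parts are subsingletons (`bpJPp_subsingleton`,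
  `bpJPn_subsingleton`); a tropical part confined to one layer has `≤ 4` indices (`bp_ncard_le_four_of_sameLayer`).
* **Interlayer upper bound** `bp_interlayer_upper`: in the regime `a(1 - 1/50) ≤ a' ≤ a(1 + 1/50)` with consecutive
  layers `≥ a(1 - 1/50)` apart, all increments are `≥ 39a/50` (`bp_incr_ge`), and if
  `a'²/3 + (z(m+1) - z m)² > (a(1 + 1/50))²` the index shell of `(m, 0, 0)` is covered by the six in-layer
  neighbours and the block of layer `m - 1` (`bp_interlayer_cover`): `6 + 4 < 12`.
-/

noncomputable section

namespace Summit.AtomisticToContinuum.Crystallization.Theorems.CleanHull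

open Filter Literature.MathematicalPhysics.StatisticalMechanics Literature.Geometry.DiscreteGeometry

/-! ## Polar and tropical parts (regime `a' ≥ 63a/50`) -/

/-- In the regime `a' ≥ 63a/50`, every index of the shell of `(m, 0, 0)` is polar or tropical, above or below.
[folklore] -/
theorem bpJ_subset {a a' : ℝ} {s : ℤ → ℤ} {z : ℤ → ℝ} (ha : 0 < a) (hbig : a * (63 / 50) ≤ a') (m : ℤ) :
    bpJ a a' s z m ⊆ (bpJPp a a' s z m ∪ bpJBp a a' s z m) ∪ (bpJPn a a' s z m ∪ bpJBn a a' s z m) := by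
  rintro ⟨m', i, j⟩ ht
  obtain ⟨hne, hd⟩ := ht
  have hsq : ‖bpVec a' s z (m, 0, 0) (m', i, j)‖ ^ 2 ≤ (a * (1 + 1 / 50)) ^ 2 :=
    pow_le_pow_left₀ (norm_nonneg _) hd 2
  rw [bp_normSq_bpVec] at hsq
  simp only [sub_zero] at hsq
  have htri := bpF_trichotomy (haggLabel s m' - haggLabel s m) i j
  have hbig2 : (a * (63 / 50)) ^ 2 ≤ a' ^ 2 := pow_le_pow_left₀ (by positivity) hbig 2
  -- forms `≥ 12` are out of reach
  have hsmall : bpF (haggLabel s m' - haggLabel s m) i j = 0 ∨ bpF (haggLabel s m' - haggLabel s m) i j = 4 := by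
    rcases htri with h0 | h4 | h12 | h16
    · exact Or.inl h0
    · exact Or.inr h4
    · exfalso
      have h : (bpF (haggLabel s m' - haggLabel s m) i j : ℝ) = 12 := by exact_mod_cast h12
      rw [h] at hsq
      nlinarith [sq_nonneg (z m' - z m)]
    · exfalso
      have h : (16 : ℝ) ≤ (bpF (haggLabel s m' - haggLabel s m) i j : ℝ) := by exact_mod_cast h16
      have h' : a' ^ 2 / 12 * 16 ≤ a' ^ 2 / 12 * (bpF (haggLabel s m' - haggLabel s m) i j : ℝ) :=
        mul_le_mul_of_nonneg_left h (by positivity)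
      nlinarith [sq_nonneg (z m' - z m)]
  -- the layer is not `m`
  have hm : m' ≠ m := by
    rintro rfl
    rcases hsmall with h0 | h4
    · obtain ⟨hi, hj, -⟩ := bpF_eq_zero h0
      simp only [sub_self, Int.zero_ediv, neg_zero] at hi hj
      exact hne (by rw [hi, hj])
    · obtain ⟨-, -, hmod⟩ := bpF_eq_four h4
      simp only [sub_self] at hmod
      omega
  have hJ : ((m', i, j) : ℤ × ℤ × ℤ) ∈ bpJ a a' s z m := ⟨hne, hd⟩
  rcases lt_or_gt_of_ne hm with hlt | hgt
  · right
    rcases hsmall with h0 | h4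
    · exact Or.inl ⟨hJ, hlt, h0⟩
    · exact Or.inr ⟨hJ, hlt, h4⟩
  · left
    rcases hsmall with h0 | h4
    · exact Or.inl ⟨hJ, hgt, h0⟩
    · exact Or.inr ⟨hJ, hgt, h4⟩

/-- Arithmetic of two polar layers on the same side: impossible. [folklore] -/
theorem bp_arith_polar {a p q : ℝ} (h1 : (a * (1 - 1 / 50)) ^ 2 ≤ p ^ 2)
    (h2 : q ^ 2 ≤ (a * (1 + 1 / 50)) ^ 2) (hp : 0 < p) (hpq : p < q)
    (h : (a * (1 - 1 / 50)) ^ 2 ≤ (q - p) ^ 2) : False := by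
  nlinarith

/-- **Aligned layers are vertically `≥ a(1 - 1/50)` apart** (the site of layer `m'` straight above `(m, 0, 0)`
is a point of `Z`). [folklore] -/
theorem bp_gap_aligned {a a' : ℝ} {s : ℤ → ℤ} {z : ℤ → ℝ} (ha : 0 < a)
    (hgapI : ∀ t t' : ℤ × ℤ × ℤ, t ≠ t' → a * (1 - 1 / 50) ≤ ‖bpVec a' s z t t'‖) {m m' : ℤ} (hne : m ≠ m')
    (hmod : (haggLabel s m' - haggLabel s m) % 3 = 0) :
    (a * (1 - 1 / 50)) ^ 2 ≤ (z m' - z m) ^ 2 := by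
  set e : ℤ := (haggLabel s m' - haggLabel s m) / 3 with he
  have h := hgapI (m, 0, 0) (m', -e, -e) (by simp [hne])
  have hsq := pow_le_pow_left₀ (by positivity : 0 ≤ a * (1 - 1 / 50)) h 2
  rw [bp_normSq_bpVec] at hsq
  simp only [sub_zero] at hsq
  have hF : bpF (haggLabel s m' - haggLabel s m) (-e) (-e) = 0 := by
    have h3 : haggLabel s m' - haggLabel s m = 3 * e := by omega
    unfold bpF
    rw [h3]
    ring
  rw [hF] at hsq
  simpa using hsq

/-- The polar parts are subsingletons (above). [folklore] -/
theorem bpJPp_subsingleton {a a' : ℝ} {s : ℤ → ℤ} {z : ℤ → ℝ} (ha : 0 < a) (hzm : StrictMono z)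
    (hgapI : ∀ t t' : ℤ × ℤ × ℤ, t ≠ t' → a * (1 - 1 / 50) ≤ ‖bpVec a' s z t t'‖) (m : ℤ) :
    (bpJPp a a' s z m).Subsingleton := by
  -- ordered version
  have key : ∀ t₁ ∈ bpJPp a a' s z m, ∀ t₂ ∈ bpJPp a a' s z m, t₁.1 ≤ t₂.1 → t₁ = t₂ := by
    rintro ⟨m₁, i₁, j₁⟩ ⟨⟨hne1, hd1⟩, hm1, hF1⟩ ⟨m₂, i₂, j₂⟩ ⟨⟨hne2, hd2⟩, hm2, hF2⟩ hle
    simp only at hm1 hm2 hF1 hF2 hle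
    obtain ⟨hi1, hj1, hmod1⟩ := bpF_eq_zero hF1
    obtain ⟨hi2, hj2, hmod2⟩ := bpF_eq_zero hF2
    rcases eq_or_lt_of_le hle with heq | hlt
    · subst heq
      simp [hi1, hi2, hj1, hj2]
    · exfalso
      -- heights
      have hsq1 := pow_le_pow_left₀ (norm_nonneg _) hd1 2
      have hsq2 := pow_le_pow_left₀ (norm_nonneg _) hd2 2
      have hlo1 := pow_le_pow_left₀ (by positivity : 0 ≤ a * (1 - 1 / 50)) (hgapI _ _ hne1.symm) 2
      rw [bp_normSq_bpVec] at hsq1 hsq2 hlo1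
      simp only [sub_zero] at hsq1 hsq2 hlo1
      rw [hF1] at hlo1
      rw [hF2] at hsq2
      simp only [Int.cast_zero, mul_zero, zero_add] at hlo1 hsq2
      -- the pair
      have hne12 : ((m₁, i₁, j₁) : ℤ × ℤ × ℤ) ≠ (m₂, i₂, j₂) := by simp [hlt.ne]
      have hpair := pow_le_pow_left₀ (by positivity : 0 ≤ a * (1 - 1 / 50)) (hgapI _ _ hne12) 2
      rw [bp_normSq_bpVec] at hpair
      have hF12 : bpF (haggLabel s m₂ - haggLabel s m₁) (i₂ - i₁) (j₂ - j₁) = 0 := by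
        have hP : 2 * (i₂ - i₁) + (j₂ - j₁) + (haggLabel s m₂ - haggLabel s m₁) = 0 := by omega
        have hQ : 3 * (j₂ - j₁) + (haggLabel s m₂ - haggLabel s m₁) = 0 := by omega
        unfold bpF; rw [hP, hQ]; norm_num
      simp only [hF12, Int.cast_zero, mul_zero, zero_add] at hpair
      have h0 : 0 < z m₁ - z m := sub_pos.2 (hzm hm1)
      have h12 : z m₁ - z m < z m₂ - z m := by linarith [hzm hlt]
      exact bp_arith_polar hlo1 hsq2 h0 h12 (by
        simpa only [show z m₂ - z m₁ = (z m₂ - z m) - (z m₁ - z m) by ring] using hpair)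
  intro t₁ h₁ t₂ h₂
  rcases le_total t₁.1 t₂.1 with h | h
  · exact key t₁ h₁ t₂ h₂ h
  · exact (key t₂ h₂ t₁ h₁ h).symm

/-- The polar parts are subsingletons (below). [folklore] -/
theorem bpJPn_subsingleton {a a' : ℝ} {s : ℤ → ℤ} {z : ℤ → ℝ} (ha : 0 < a) (hzm : StrictMono z)
    (hgapI : ∀ t t' : ℤ × ℤ × ℤ, t ≠ t' → a * (1 - 1 / 50) ≤ ‖bpVec a' s z t t'‖) (m : ℤ) :
    (bpJPn a a' s z m).Subsingleton := by
  have key : ∀ t₁ ∈ bpJPn a a' s z m, ∀ t₂ ∈ bpJPn a a' s z m, t₂.1 ≤ t₁.1 → t₁ = t₂ := by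
    rintro ⟨m₁, i₁, j₁⟩ ⟨⟨hne1, hd1⟩, hm1, hF1⟩ ⟨m₂, i₂, j₂⟩ ⟨⟨hne2, hd2⟩, hm2, hF2⟩ hle
    simp only at hm1 hm2 hF1 hF2 hle
    obtain ⟨hi1, hj1, hmod1⟩ := bpF_eq_zero hF1
    obtain ⟨hi2, hj2, hmod2⟩ := bpF_eq_zero hF2
    rcases eq_or_lt_of_le hle with heq | hlt
    · subst heq
      simp [hi1, hi2, hj1, hj2]
    · exfalso
      have hsq1 := pow_le_pow_left₀ (norm_nonneg _) hd1 2
      have hsq2 := pow_le_pow_left₀ (norm_nonneg _) hd2 2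
      have hlo1 := pow_le_pow_left₀ (by positivity : 0 ≤ a * (1 - 1 / 50)) (hgapI _ _ hne1.symm) 2
      rw [bp_normSq_bpVec] at hsq1 hsq2 hlo1
      simp only [sub_zero] at hsq1 hsq2 hlo1
      rw [hF1] at hlo1
      rw [hF2] at hsq2
      simp only [Int.cast_zero, mul_zero, zero_add] at hlo1 hsq2
      have hne12 : ((m₁, i₁, j₁) : ℤ × ℤ × ℤ) ≠ (m₂, i₂, j₂) := by simp [hlt.ne']
      have hpair := pow_le_pow_left₀ (by positivity : 0 ≤ a * (1 - 1 / 50)) (hgapI _ _ hne12) 2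
      rw [bp_normSq_bpVec] at hpair
      have hF12 : bpF (haggLabel s m₂ - haggLabel s m₁) (i₂ - i₁) (j₂ - j₁) = 0 := by
        have hP : 2 * (i₂ - i₁) + (j₂ - j₁) + (haggLabel s m₂ - haggLabel s m₁) = 0 := by omega
        have hQ : 3 * (j₂ - j₁) + (haggLabel s m₂ - haggLabel s m₁) = 0 := by omega
        unfold bpF; rw [hP, hQ]; norm_num
      simp only [hF12, Int.cast_zero, mul_zero, zero_add] at hpair
      have h0 : 0 < z m - z m₁ := sub_pos.2 (hzm hm1)
      have h12 : z m - z m₁ < z m - z m₂ := by linarith [hzm hlt]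
      refine bp_arith_polar (p := z m - z m₁) (q := z m - z m₂) (by
        simpa only [show z m₁ - z m = -(z m - z m₁) by ring, neg_sq] using hlo1) (by
        simpa only [show z m₂ - z m = -(z m - z m₂) by ring, neg_sq] using hsq2) h0 h12 (by
        simpa only [show z m₂ - z m₁ = -((z m - z m₂) - (z m - z m₁)) by ring, neg_sq] using hpair)
  intro t₁ h₁ t₂ h₂
  rcases le_total t₂.1 t₁.1 with h | h
  · exact key t₁ h₁ t₂ h₂ h
  · exact (key t₂ h₂ t₁ h₁ h).symm

/-- A tropical part all of whose indices lie in one layer has at most four elements. [folklore] -/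
theorem bp_ncard_le_four_of_sameLayer {s : ℤ → ℤ} {m : ℤ} {B : Set (ℤ × ℤ × ℤ)}
    (hB : ∀ t ∈ B, bpF (haggLabel s t.1 - haggLabel s m) t.2.1 t.2.2 = 4)
    (hsame : ∀ t₁ ∈ B, ∀ t₂ ∈ B, t₁.1 = t₂.1) : B.ncard ≤ 4 := by
  rcases B.eq_empty_or_nonempty with rfl | ⟨t₁, ht₁⟩
  · simp
  set e : ℤ := (haggLabel s t₁.1 - haggLabel s m) / 3 with he
  have hsub : B ⊆ ↑(({t₁.1} ×ˢ bpBlock e : Finset (ℤ × ℤ × ℤ))) := by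
    rintro ⟨m', i, j⟩ ht
    have hm : m' = t₁.1 := hsame _ ht _ ht₁
    simp only [Finset.coe_product, Finset.coe_singleton, Set.mem_prod, Set.mem_singleton_iff,
      Finset.mem_coe]
    refine ⟨hm, ?_⟩
    have h4 := hB _ ht
    simp only at h4
    rw [he, ← hm]
    exact mem_bpBlock_of_bpF_eq_four h4
  refine (Set.ncard_le_ncard hsub (Finset.finite_toSet _)).trans ?_
  rw [Set.ncard_coe_finset, Finset.card_product, Finset.card_singleton, one_mul]
  exact card_bpBlock_le e

/-! ## The interlayer upper bound (regime `0.98 a ≤ a' ≤ 1.02 a`) -/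

/-- In the regime `a' ≤ a(1 + 1/50)`, the consecutive-layer separation forces every increment to be
`≥ 39a/50`. [folklore] -/
theorem bp_incr_ge {a a' : ℝ} {z : ℤ → ℝ} (ha : 0 ≤ a) (hhi : a' ≤ a * (1 + 1 / 50)) (ha' : 0 ≤ a')
    (hz : ∀ m : ℤ, 0 < z (m + 1) - z m)
    (hsep : ∀ k : ℤ, (a * (1 - 1 / 50)) ^ 2 ≤ a' ^ 2 / 3 + (z (k + 1) - z k) ^ 2) (k : ℤ) :
    39 / 50 * a ≤ z (k + 1) - z k := by
  have h1 := hsep k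
  have h2 := hz k
  have h3 : a' ^ 2 ≤ (a * (1 + 1 / 50)) ^ 2 := pow_le_pow_left₀ ha' hhi 2
  nlinarith

/-- Arithmetic of the far layers: a vertical offset `≥ 39a/25` is out of reach. [folklore] -/
theorem bp_arith_far {a T H : ℝ} (ha : 0 < a) (hT : 0 ≤ T) (hsq : T + H ^ 2 ≤ (a * (1 + 1 / 50)) ^ 2)
    (hH : 39 / 25 * a ≤ |H|) : False := by
  have h1 : (39 / 25 * a) ^ 2 ≤ |H| ^ 2 := pow_le_pow_left₀ (by positivity) hH 2
  rw [sq_abs] at h1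
  nlinarith

/-- Arithmetic of the layer `m - 1`: an in-plane form `≥ 12` is out of reach. [folklore] -/
theorem bp_arith_prev {a a' F H : ℝ} (ha : 0 < a) (hlo : a * (1 - 1 / 50) ≤ a') (hF : 12 ≤ F)
    (hsq : a' ^ 2 / 12 * F + H ^ 2 ≤ (a * (1 + 1 / 50)) ^ 2) (hH : 39 / 50 * a ≤ |H|) : False := by
  have h1 : (39 / 50 * a) ^ 2 ≤ |H| ^ 2 := pow_le_pow_left₀ (by positivity) hH 2
  rw [sq_abs] at h1
  have h2 : (a * (1 - 1 / 50)) ^ 2 ≤ a' ^ 2 := pow_le_pow_left₀ (by positivity) hlo 2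
  have h3 : a' ^ 2 ≤ a' ^ 2 / 12 * F := by nlinarith
  nlinarith

/-- Arithmetic of the layer `m`: an in-plane form `≥ 16` is out of reach. [folklore] -/
theorem bp_arith_same {a a' F H : ℝ} (ha : 0 < a) (hlo : a * (1 - 1 / 50) ≤ a') (hF : 16 ≤ F)
    (hsq : a' ^ 2 / 12 * F + H ^ 2 ≤ (a * (1 + 1 / 50)) ^ 2) : False := by
  have h2 : (a * (1 - 1 / 50)) ^ 2 ≤ a' ^ 2 := pow_le_pow_left₀ (by positivity) hlo 2
  have h3 : 4 / 3 * a' ^ 2 ≤ a' ^ 2 / 12 * F := by nlinarith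
  nlinarith [sq_nonneg H]

/-- The cover step of the interlayer upper bound: in the regime `a(1 - 1/50) ≤ a' ≤ a(1 + 1/50)`, increments
`≥ 39a/50` and `a'²/3 + (z (m+1) - z m)² > (a(1 + 1/50))²`, an index `(m', i, j) ≠ (m, 0, 0)` within reach of
`(m, 0, 0)` is one of the six in-layer neighbours or lies in the block of layer `m - 1`. [folklore] -/
theorem bp_interlayer_cover {a a' : ℝ} {s : ℤ → ℤ} {z : ℤ → ℝ} (ha : 0 < a) (hs : IsHaggSeq s)
    (hzm : StrictMono z) (hlo : a * (1 - 1 / 50) ≤ a')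
    (hincr : ∀ k : ℤ, 39 / 50 * a ≤ z (k + 1) - z k) {m : ℤ}
    (hlt : (a * (1 + 1 / 50)) ^ 2 < a' ^ 2 / 3 + (z (m + 1) - z m) ^ 2) {m' i j : ℤ}
    (hne : ((m', i, j) : ℤ × ℤ × ℤ) ≠ (m, 0, 0))
    (hsq : ‖bpVec a' s z (m, 0, 0) (m', i, j)‖ ^ 2 ≤ (a * (1 + 1 / 50)) ^ 2) :
    (m' = m ∧ (i, j) ∈ bpHex) ∨ (m' = m - 1 ∧ (i, j) ∈ bpBlock ((haggLabel s (m - 1) - haggLabel s m) / 3)) := by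
  rw [bp_normSq_bpVec] at hsq
  simp only [sub_zero] at hsq
  -- the in-plane form, as an opaque integer
  have htri := bpF_trichotomy (haggLabel s m' - haggLabel s m) i j
  generalize hFdef : bpF (haggLabel s m' - haggLabel s m) i j = Fz at hsq htri
  have hF0 : (0 : ℝ) ≤ (Fz : ℝ) := by
    rw [← hFdef]; unfold bpF; push_cast; positivity
  rcases lt_trichotomy m' m with hlt | rfl | hgt
  · -- layers below
    rcases lt_or_eq_of_le (Int.le_sub_one_of_lt hlt) with hlt2 | rfl
    · -- two or more layers below: too far
      exfalso
      have h1 := hincr (m - 1)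
      have h2 := hincr (m - 2)
      rw [sub_add_cancel] at h1
      rw [show m - 2 + 1 = m - 1 by ring] at h2
      have h3 : z m' ≤ z (m - 2) := hzm.monotone (by omega)
      refine bp_arith_far ha (by positivity) hsq ?_
      rw [abs_sub_comm, abs_of_nonneg (by linarith)]
      linarith
    · -- the layer `m - 1`: the in-plane form must be `4`
      right
      refine ⟨rfl, ?_⟩
      have h1 := hincr (m - 1)
      rw [sub_add_cancel] at h1
      have hδ : haggLabel s m = haggLabel s (m - 1) + s (m - 1) := by
        have := haggLabel_succ s (m - 1); rwa [sub_add_cancel] at this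
      have habs : 39 / 50 * a ≤ |z (m - 1) - z m| := by
        rw [abs_sub_comm, abs_of_nonneg (by linarith)]; linarith
      rcases htri with h0 | h4 | h12 | h16
      · exfalso
        obtain ⟨-, -, hmod⟩ := bpF_eq_zero (hFdef.trans h0)
        rcases hs (m - 1) with h | h <;> omega
      · exact mem_bpBlock_of_bpF_eq_four (hFdef.trans h4)
      · exfalso
        have : (12 : ℝ) ≤ (Fz : ℝ) := by exact_mod_cast h12.ge
        exact bp_arith_prev ha hlo this hsq habs
      · exfalso
        have : (12 : ℝ) ≤ (Fz : ℝ) := by exact_mod_cast (show (12 : ℤ) ≤ Fz by omega)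
        exact bp_arith_prev ha hlo this hsq habs
  · -- the layer `m` itself: the six neighbours
    left
    refine ⟨rfl, ?_⟩
    simp only [sub_self] at hsq hFdef
    rcases htri with h0 | h4 | h12 | h16
    · exfalso
      obtain ⟨hi, hj, -⟩ := bpF_eq_zero (hFdef.trans h0)
      simp only [Int.zero_ediv, neg_zero] at hi hj
      exact hne (by rw [hi, hj])
    · exfalso
      obtain ⟨-, -, hmod⟩ := bpF_eq_four (hFdef.trans h4)
      omega
    · exact bpF_zero_eq_twelve (hFdef.trans h12)
    · exfalso
      have : (16 : ℝ) ≤ (Fz : ℝ) := by exact_mod_cast h16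
      exact bp_arith_same ha hlo this hsq
  · -- layers above: too far
    exfalso
    rcases lt_or_eq_of_le (Int.add_one_le_of_lt hgt) with hgt2 | heq
    · have h1 := hincr m
      have h2 := hincr (m + 1)
      have h3 : z (m + 1 + 1) ≤ z m' := hzm.monotone (by omega)
      refine bp_arith_far ha (by positivity) hsq ?_
      rw [abs_of_nonneg (by linarith)]
      linarith
    · have hδ : haggLabel s m' - haggLabel s m = s m := by rw [← heq, haggLabel_succ]; ring
      rw [hδ] at hFdef
      rw [← heq] at hsq
      have h4le : (4 : ℤ) ≤ Fz := by
        rcases htri with h0 | h4 | h12 | h16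
        · exfalso
          obtain ⟨-, -, hmod⟩ := bpF_eq_zero (hFdef.trans h0)
          rcases hs m with h | h <;> omega
        · exact h4.ge
        · omega
        · omega
      have h4le' : (4 : ℝ) ≤ (Fz : ℝ) := by exact_mod_cast h4le
      have h5 : 0 ≤ a' ^ 2 / 12 * ((Fz : ℝ) - 4) := mul_nonneg (by positivity) (by linarith)
      linarith

/-- **Interlayer upper bound.** In the regime `a(1 - 1/50) ≤ a' ≤ a(1 + 1/50)` with all consecutive layers
`≥ a(1 - 1/50)` apart, the count "exactly twelve within `a(1 + 1/50)`" at the site `(m, 0, 0)` forces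
`a'²/3 + (z (m+1) - z m)² ≤ (a (1 + 1/50))²`: otherwise only the six in-layer neighbours and at most four
sites of layer `m - 1` are within reach (`6 + 4 < 12`). [folklore] -/
theorem bp_interlayer_upper {a a' : ℝ} {s : ℤ → ℤ} {z : ℤ → ℝ} (ha : 0 < a) (hs : IsHaggSeq s)
    (hz : ∀ m : ℤ, 0 < z (m + 1) - z m) (hlo : a * (1 - 1 / 50) ≤ a') (hhi : a' ≤ a * (1 + 1 / 50))
    (hsep : ∀ k : ℤ, (a * (1 - 1 / 50)) ^ 2 ≤ a' ^ 2 / 3 + (z (k + 1) - z k) ^ 2)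
    (hcountI : ∀ t₀ : ℤ × ℤ × ℤ, {t : ℤ × ℤ × ℤ | t ≠ t₀ ∧ ‖bpVec a' s z t₀ t‖ ≤ a * (1 + 1 / 50)}.ncard = 12)
    (m : ℤ) : a' ^ 2 / 3 + (z (m + 1) - z m) ^ 2 ≤ (a * (1 + 1 / 50)) ^ 2 := by
  by_contra hlt
  have hlt' := not_le.1 hlt
  have ha' : 0 < a' := by linarith
  have hzm : StrictMono z := strictMono_int_of_lt_succ fun n => by linarith [hz n]
  have hincr := bp_incr_ge ha.le hhi ha'.le hz hsep
  -- the cover of the index shell of `(m, 0, 0)`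
  set e : ℤ := (haggLabel s (m - 1) - haggLabel s m) / 3 with he
  have hcard : (({m} ×ˢ bpHex) ∪ ({m - 1} ×ˢ bpBlock e) : Finset (ℤ × ℤ × ℤ)).card ≤ 10 := by
    refine (Finset.card_union_le _ _).trans ?_
    rw [Finset.card_product, Finset.card_product, Finset.card_singleton, Finset.card_singleton]
    have := card_bpHex_le
    have := card_bpBlock_le e
    omega
  have hsub : {t : ℤ × ℤ × ℤ | t ≠ (m, 0, 0) ∧ ‖bpVec a' s z (m, 0, 0) t‖ ≤ a * (1 + 1 / 50)} ⊆
      ↑(({m} ×ˢ bpHex) ∪ ({m - 1} ×ˢ bpBlock e) : Finset (ℤ × ℤ × ℤ)) := by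
    rintro ⟨m', i, j⟩ ⟨hne, hd⟩
    have hsq : ‖bpVec a' s z (m, 0, 0) (m', i, j)‖ ^ 2 ≤ (a * (1 + 1 / 50)) ^ 2 :=
      pow_le_pow_left₀ (norm_nonneg _) hd 2
    have h := bp_interlayer_cover ha hs hzm hlo hincr hlt' hne hsq
    simp only [Finset.coe_union, Set.mem_union, Finset.mem_coe, Finset.mem_product, Finset.mem_singleton]
    exact h
  have h12 := hcountI (m, 0, 0)
  have hle : {t : ℤ × ℤ × ℤ | t ≠ (m, 0, 0) ∧ ‖bpVec a' s z (m, 0, 0) t‖ ≤ a * (1 + 1 / 50)}.ncard ≤ 10 :=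
    (Set.ncard_le_ncard hsub (Finset.finite_toSet _)).trans ((Set.ncard_coe_finset _).le.trans hcard)
  omega

end Summit.AtomisticToContinuum.Crystallization.Theorems.CleanHull

end
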